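import Summits.BirchSwinnertonDyer.BirchSwinnertonDyer.Theorems.ByReductionTypeAtTwoSupersingularFlatBlindLocalTransversalityApZero
import Literature.NumberTheory.EllipticCurves.LocalPointsFiniteIndexLatticeHolds
import HarnessLib

/-!
# Route `ByReductionTypeAtTwo` (rung K4), crux `SupersingularRankZeroAtTwo` (item stmt-BirchSwinnertonDyer-19097):
# CDF local transversality at `a₂ = 0` FOR EVERY NON-TORSION `ψ₂`-VECTOR — the non-divisibility hypothesis of
# `…FlatBlindLocalTransversalityApZero.lean` discharged by Silverman VII.6.3 (a finite-index `ℤ₂`-lattice in `E(ℚ_{1,v})`)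
# (seat `bsd-2adic-ss-1`, GEN 18, LEAD attack (L2), part 3)

HONEST FRAMING (cell `bsd-2adic`): THEOREMS ONLY; no definition, no named fact, no `sorry`, no instance; nothing booked; BSD is not
proved by any of this. PARTITION: X5@2 good-ss r₀, `a₂ = 0` sub-row × p = 2 — types-the-object-of; closes none. bears_on: K4 (19097).

## What is proved
* `OddBlindLocal.exists_forall_nsmul_ne_of_forall_nsmul_ne_zero` — a point `y ∈ E(K_n·ℚ_v)` of INFINITE ORDER is not infinitely
  `2`-divisible there: `∃ k, ∀ w ∈ E(K_n·ℚ_v), 2^k·w ≠ y` (the finite-index lattice `H ≃ ℤ₂^d` of the tree THEOREM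
  `silvermanVII63_localLayerPoints_finiteIndex_zpLattice_holds`: `[E:H]·y ∈ ⋂ₖ 2^k H = 0`).
* ★★★ `OddBlindLocal.exists_mem_colemanKer_flat_apply_ne_zero_of_frobeniusTrace_eq_zero_of_infinite_order` — the `a₂ = 0` local
  transversality of the ♭ condition at `ψ₂` in the shape the GLOBAL half will consume: for every `ψ₂`-vector `y ∈ E(ℚ_{1,v})`
  (`g·y = −y`) of infinite order (e.g. the image of the non-torsion rational point of the twist `E^{(2)}`), some `z ∈ Ker Col♭`
  has `z(y) ≠ 0` — for ANY (L)(TR)-system `c` of the registered line.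

References: [SilvermanAEC2009] VII.6.3; [Kobayashi2003] Prop. 8.12 ii); [Sprung2012] Def. 7.9.
-/

set_option autoImplicit false
set_option linter.dupNamespace false

noncomputable section

open scoped Classical NumberField

namespace Summit.BirchSwinnertonDyer.BirchSwinnertonDyer.Theorems

namespace OddBlindLocal

open NumberField IsDedekindDomain Literature.NumberTheory.EllipticCurves Literature.NumberTheory.GaloisRepresentations
  ZpExtension Literature.NumberTheory.EllipticCurves.Kobayashi2003 Literature.NumberTheory.EllipticCurves.Sprung2017
  Literature.NumberTheory.EllipticCurves.Sprung2012 Literature.NumberTheory.EllipticCurves.Rank1Residual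

variable (W : WeierstrassCurve ℚ) [W.IsElliptic]

/-- **A point of infinite order in `E(K_n·ℚ_v)` is not infinitely `2`-divisible there** (`v ∋ 2`, any `ℤ₂`-extension `κ`, any
embedding, any layer): by Silverman VII.6.3 (tree theorem `silvermanVII63_localLayerPoints_finiteIndex_zpLattice_holds`) the layer
contains a finite-index subgroup `H ≃ ℤ₂^d`; if `y = 2^k w_k` for every `k` then `[E:H]·y ∈ ⋂ₖ 2^k·H`, whose image in `ℤ₂^d` is
divisible by every `2^k`, hence `0` — so `[E:H]·y = 0`, contradicting infinite order. [cite: SilvermanAEC2009, Prop. VII.6.3] -/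
theorem exists_forall_nsmul_ne_of_forall_nsmul_ne_zero (κ : ZpExtension ℚ 2) (v : HeightOneSpectrum (𝓞 ℚ))
    (hv : (2 : 𝓞 ℚ) ∈ v.asIdeal) (ι : AlgebraicClosure ℚ →ₐ[ℚ] AlgebraicClosure (v.adicCompletion ℚ)) (n : ℕ)
    {y : localPoints W (v.adicCompletion ℚ)} (hy : y ∈ localLayerPointsOfEmb κ ι W n)
    (htors : ∀ m : ℕ, m ≠ 0 → m • y ≠ 0) :
    ∃ k : ℕ, ∀ w ∈ localLayerPointsOfEmb κ ι W n, 2 ^ k • w ≠ y := by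
  obtain ⟨H, hHle, hfi, ⟨φ⟩⟩ :=
    silvermanVII63_localLayerPoints_finiteIndex_zpLattice_holds ℚ 2 κ v (by exact_mod_cast hv) ι W n
  by_contra hall
  push Not at hall
  -- the index `m₀ = [E(K_n·ℚ_v) : H]`
  set L := localLayerPointsOfEmb κ ι W n with hL
  haveI := hfi
  set m₀ := (H.addSubgroupOf L).index with hm₀
  have hm₀0 : m₀ ≠ 0 := AddSubgroup.FiniteIndex.index_ne_zero
  -- `m₀ • w ∈ H` for every `w ∈ L`
  have hmul : ∀ w ∈ L, m₀ • w ∈ H := by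
    intro w hw
    have h := (H.addSubgroupOf L).nsmul_index_mem ⟨w, hw⟩
    rw [AddSubgroup.mem_addSubgroupOf] at h
    exact h
  -- the image `a = φ(m₀ • y) ∈ ℤ₂^d` is divisible by every `2^k`
  have hmy : m₀ • y ∈ H := hmul y hy
  set a := φ ⟨m₀ • y, hmy⟩ with ha
  have hdiv : ∀ (k : ℕ) (i : _), (2 : ℤ_[2]) ^ k ∣ a i := by
    intro k i
    obtain ⟨w, hw, hwy⟩ := hall k
    have hmw : m₀ • w ∈ H := hmul w hw
    have hy' : (⟨m₀ • y, hmy⟩ : H) = 2 ^ k • ⟨m₀ • w, hmw⟩ := by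
      apply Subtype.ext
      change m₀ • y = 2 ^ k • (m₀ • w)
      rw [← hwy, smul_comm]
    refine ⟨φ ⟨m₀ • w, hmw⟩ i, ?_⟩
    rw [ha, hy', map_nsmul, Pi.smul_apply, nsmul_eq_mul, Nat.cast_pow, Nat.cast_ofNat]
  have ha0 : a = 0 := by
    funext i
    exact SSFlatEC.padicInt_eq_zero_of_forall_pow_dvd fun k ↦ hdiv k i
  have hmy0 : m₀ • y = 0 := by
    have h : (⟨m₀ • y, hmy⟩ : H) = 0 := φ.injective (by rw [← ha, ha0, map_zero])
    exact congrArg Subtype.val h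
  exact htors m₀ hm₀0 hmy0

variable [W.IsGloballyMinimal]

/-- ★★★ **LOCAL TRANSVERSALITY OF THE ♭ CONDITION AT `ψ₂`, `a₂ = 0`, FOR EVERY `ψ₂`-VECTOR OF INFINITE ORDER.**  `W/ℚ` globally
minimal, `GoodSS W 2`, `a₂(W) = 0`, `κ` cyclotomic, `v ∋ 2`, `g` a local lift of the topological generator, `c` ANY local system with
the registered line's clauses (L)(TR), and `y ∈ E(ℚ_{1,v})` with `g·y = −y` of infinite order: **some `z ∈ Ker Col♭` has `z(y) ≠ 0`**
— the ψ₂-part of Sprung's `E^♭ = Ann(Ker Col♭)` does NOT contain the Kummer line through `y`.  Composition of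
`exists_forall_nsmul_ne_of_forall_nsmul_ne_zero` with `exists_mem_colemanKer_flat_apply_ne_zero_of_frobeniusTrace_eq_zero`.
[cite: Kobayashi2003, Prop. 8.12 ii) (p. 17)] [cite: Sprung2012, Def. 7.9 (p. 1503)] [cite: SilvermanAEC2009, Prop. VII.6.3] -/
theorem exists_mem_colemanKer_flat_apply_ne_zero_of_frobeniusTrace_eq_zero_of_infinite_order (hss : GoodSS W 2)
    (ha : W.frobeniusTrace 2 = 0) {κ : ZpExtension ℚ 2} (hκ : κ.IsCyclotomic)
    (v : HeightOneSpectrum (𝓞 ℚ)) (hv : (2 : 𝓞 ℚ) ∈ v.asIdeal)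
    {g : Field.absoluteGaloisGroup (v.adicCompletion ℚ)}
    (hg : κ.IsTopGenerator (resGalOfEmb (closureEmb (K := ℚ) (v.adicCompletion ℚ)) g))
    {c : ℕ → localPoints W (v.adicCompletion ℚ)}
    (hc : ∀ n, c n ∈ localLayerPointsOfEmb κ (closureEmb (K := ℚ) (v.adicCompletion ℚ)) W n)
    (htr : ∀ n, 1 ≤ n → localTraceOfEmb κ (closureEmb (K := ℚ) (v.adicCompletion ℚ)) W n (n + 1)
      (c (n + 1)) = W.frobeniusTrace 2 • c n - c (n - 1))
    {y : localPoints W (v.adicCompletion ℚ)}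
    (hy : y ∈ localLayerPointsOfEmb κ (closureEmb (K := ℚ) (v.adicCompletion ℚ)) W 1) (hgy : g • y = -y)
    (htors : ∀ m : ℕ, m ≠ 0 → m • y ≠ 0) :
    ∃ z ∈ colemanKer κ (closureEmb (K := ℚ) (v.adicCompletion ℚ)) W (W.frobeniusTrace 2) g c .flat,
      z ⟨y, localLayerPointsOfEmb_le_localTowerPointsOfEmb κ (closureEmb (K := ℚ) (v.adicCompletion ℚ)) W 1 hy⟩ ≠ 0 := by
  obtain ⟨k, hk⟩ := exists_forall_nsmul_ne_of_forall_nsmul_ne_zero W κ v hv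
    (closureEmb (K := ℚ) (v.adicCompletion ℚ)) 1 hy htors
  exact exists_mem_colemanKer_flat_apply_ne_zero_of_frobeniusTrace_eq_zero W hss ha hκ v hv hg hc htr hy hgy hk

end OddBlindLocal

end Summit.BirchSwinnertonDyer.BirchSwinnertonDyer.Theorems

end
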